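import Literature.AlgebraicGeometry.Frobenioids.Frobenioid
import Literature.AlgebraicGeometry.Frobenioids.GroupSubfunctors
import HarnessLib

/-!
# Frobenioids I: the rational-function subfunctor `Φ^birat ⊆ Φ^gp` of a pre-Frobenioid, concretely

Mochizuki, *The geometry of Frobenioids I: the general theory*, Kyushu J. Math. **62** (2008)
293–400, Proposition 4.4 (iii)/(iv) p. 83 with proof p. 84 l. 52, and the use made of it in the
proof of Theorem 5.1 (i), p. 97 ll. 41–44 [cite: MochizukiFrdI2008, Prop. 4.4 (iii) p.83]
[cite: MochizukiFrdI2008, Thm. 5.1 (i) p.97].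

**What this file is.** Proposition 4.4 (iii) (p. 83) asserts "a unique subfunctor of groups
`Φ^birat ⊆ Φ^gp` such that the functor `C^birat → F_{Φ^gp}` of (i) factors through `F_{Φ^birat}`, and
… induces, for each `A^birat`, a surjection `O^×(A^birat) ↠ Φ^birat(A^birat)`". By (iv) (p. 83, last
lines) the base-identity endomorphisms of `A^birat` are the base-equivalent pairs
`(α : A' → A` a co-angular pre-step`, φ : A' → A)`, and the functor of (i) sends such a pair to
`Φ(α)⁻¹{Div(φ) − deg_Fr(φ) · Div(α)} ∈ Φ(A)^gp` (proof of (i), p. 84 l. 52); accordingly the proof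
of Theorem 5.1 (i) (p. 97 ll. 41–44) reads membership in `Φ^birat(A)` as: "there exists a pair of
base-equivalent pre-steps `δ₁, δ₂ : D → A` such that `Φ(δ₁)⁻¹(Div(δ₁)) + … = Φ(δ₂)⁻¹(Div(δ₂)) + …`",
i.e. the elements of `Φ^birat(A)` are the differences `Φ(δ₁)⁻¹(Div(δ₁)) − Φ(δ₂)⁻¹(Div(δ₂))` over
base-equivalent pairs (`δ₁` a co-angular pre-step, `δ₂` a pre-step) into `A` with a common domain
(in Thm. 5.1, `C` is of isotropic type, so every pre-step is co-angular, Prop. 1.4 (i)).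

Here (seat abc-iut-L1-t5, ONE WRITER of the concrete subfunctor per L1-lead RULING W2-4,
2026-08-25T19:01Z) we DEFINE, for a pre-Frobenioid structure `F : C ⥤ F_Φ`:
* `biratGerms F A ⊆ Φ^gp(A_D)` — the set of those differences ("germs" of rational functions at
  `A`);
* `biratSubfunctor F : GpSubfunctor Φ` — the subfunctor of groups of `Φ^gp` GENERATED by the germs
  (the smallest family of subgroups `Φ^birat(X) ⊆ Φ(X)^gp`, `X ∈ Ob(D)`, stable under all pull-back
  maps `Φ(f)` and containing `biratGerms F A` in `Φ^birat(Base A)` for every `A ∈ Ob(C)`).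
For a Frobenioid, Prop. 4.4 (iii) says that `Φ^birat` exists as a subfunctor with
`Φ^birat(Base A) =` (image of `O^×(A^birat)`) `=` the germs at `A`; any such subfunctor contains the
generated one and agrees with it at every `Base A`, so `biratSubfunctor F` IS the `Φ^birat` of
Prop. 4.4 (iii). That identification with the abstract interface `PreFrobenioidData.BiratData` /
`Prop44iii` of the §4 files is a merge debt: `TODO-merge abc-iut-L1-t3: Prop 4.4 (iii) compat`
(L1-lead C5). The §5 statements (Theorem 5.1, Propositions 5.3, 5.5) are typed over a general
`Ψ : GpSubfunctor Φ` and instantiated with `biratSubfunctor F`.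
Multiplicative rendering: `Φ(δ₁)⁻¹(Div δ₁) − Φ(δ₂)⁻¹(Div δ₂) ↦ of (invDiv δ₁) / of (invDiv δ₂)` in
`Φ^gp = Algebra.GrothendieckGroup`, with `invDiv` = `(Base δ)⁻¹^*(Div δ)` (file `Frobenioid.lean`).
-/

namespace Literature.AlgebraicGeometry.Frobenioids

open CategoryTheory Opposite

universe w v v' u u'

namespace PreFrobenioid

variable {D : Type u} [Category.{v} D] {Φ : Dᵒᵖ ⥤ CommMonCat.{w}}
  {C : Type u'} [Category.{v'} C] (F : C ⥤ ElemFrobenioid Φ)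

/-- The *birational germs* at `A ∈ Ob(C)`: the elements `Φ(δ₁)⁻¹(Div(δ₁)) − Φ(δ₂)⁻¹(Div(δ₂))` of
`Φ^gp(A_D)` for pairs `(δ₁, δ₂ : Y → A)` with `δ₁` a CO-ANGULAR pre-step and `δ₂` a pre-step
base-equivalent to `δ₁` (Prop. 4.4 (iv) p. 83 ll. 38–41: "a pair `(α : A' → A; φ : A' → A)`, where `α`
is a co-angular pre-step … and `α` and `φ` are base-equivalent" — `φ` is then co-angular too, Def. 1.3
(iii)(b)); these are the elements of `Φ^birat(A)` as read in the proof of Thm. 5.1 (i), p. 97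
ll. 41–44, where `C` is of isotropic type and every pre-step is co-angular (Prop. 1.4 (i)).
[cite: MochizukiFrdI2008, Prop. 4.4 (iv) p.83] -/
def biratGerms (A : C) : Set (Algebra.GrothendieckGroup (Φ.obj (op (baseObj F A)))) :=
  {d | ∃ (Y : C) (δ₁ δ₂ : Y ⟶ A) (h₁ : IsCoAngularPreStep F δ₁) (h₂ : IsPreStep F δ₂),
      BaseEquivalent F δ₁ δ₂ ∧
        d = Algebra.GrothendieckGroup.of (invDiv F δ₁ h₁.2.2) /
              Algebra.GrothendieckGroup.of (invDiv F δ₂ h₂.2)}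

/-- The generators of `Φ^birat(X)`, `X ∈ Ob(D)`: pull-backs `Φ(f)(d)` along morphisms
`f : X → Base(A)` of birational germs `d` at objects `A` of `C`.
[cite: MochizukiFrdI2008, Prop. 4.4 (iii) p.83] -/
def biratGenerators (X : D) : Set (Algebra.GrothendieckGroup (Φ.obj (op X))) :=
  {c | ∃ (A : C) (f : X ⟶ baseObj F A) (d : Algebra.GrothendieckGroup (Φ.obj (op (baseObj F A)))),
      d ∈ biratGerms F A ∧ c = pullGp Φ f d}

/-- **`Φ^birat ⊆ Φ^gp`** (FrdI Prop. 4.4 (iii) p. 83), concretely for a pre-Frobenioid structure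
`F : C → F_Φ`: the subfunctor of groups of `Φ^gp` generated by the birational germs, i.e.
`Φ^birat(X) :=` the subgroup of `Φ(X)^gp` generated by the `Φ(f)(d)`, `f : X → Base(A)`, `d` a germ at
`A`. For a Frobenioid this is the unique subfunctor of Prop. 4.4 (iii) (see the module docstring);
`TODO-merge abc-iut-L1-t3: Prop 4.4 (iii) compat` with `PreFrobenioidData.BiratData`/`Prop44iii`.
[cite: MochizukiFrdI2008, Prop. 4.4 (iii) p.83] -/
def biratSubfunctor : GpSubfunctor Φ where
  carrier X := Subgroup.closure (biratGenerators F X)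
  pull_mem := by
    intro X Y g c hc
    have hle : (Subgroup.closure (biratGenerators F Y)).map (pullGp Φ g) ≤
        Subgroup.closure (biratGenerators F X) := by
      rw [MonoidHom.map_closure]
      apply Subgroup.closure_mono
      rintro _ ⟨c, ⟨A, f, d, hd, rfl⟩, rfl⟩
      exact ⟨A, g ≫ f, d, hd, by rw [pullGp_comp]⟩
    exact hle (Subgroup.mem_map_of_mem _ hc)

/-- `Φ^birat(X)` is, by definition, generated by the pulled-back germs.
[cite: MochizukiFrdI2008, Prop. 4.4 (iii) p.83] -/
theorem biratSubfunctor_carrier (X : D) :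
    (biratSubfunctor F).carrier X = Subgroup.closure (biratGenerators F X) := rfl

/-- Every birational germ at `A` lies in `Φ^birat(Base A)` (take `f = id`).
[cite: MochizukiFrdI2008, Prop. 4.4 (iii) p.83] -/
theorem mem_biratSubfunctor_of_mem_biratGerms {A : C}
    {d : Algebra.GrothendieckGroup (Φ.obj (op (baseObj F A)))} (hd : d ∈ biratGerms F A) :
    d ∈ (biratSubfunctor F).carrier (baseObj F A) :=
  Subgroup.subset_closure ⟨A, 𝟙 _, d, hd, by rw [pullGp_id]⟩

/-- The difference `Φ(δ₁)⁻¹(Div δ₁) − Φ(δ₂)⁻¹(Div δ₂)` of two base-equivalent pre-steps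
`δ₁, δ₂ : Y → A` lies in `Φ^birat(Base A)` (the form in which Thm. 5.1 (i)'s proof uses `Φ^birat`,
p. 97 ll. 41–44). [cite: MochizukiFrdI2008, Thm. 5.1 (i) p.97] -/
theorem div_invDiv_mem_biratSubfunctor {Y A : C} (δ₁ δ₂ : Y ⟶ A) (h₁ : IsCoAngularPreStep F δ₁)
    (h₂ : IsPreStep F δ₂) (hb : BaseEquivalent F δ₁ δ₂) :
    Algebra.GrothendieckGroup.of (invDiv F δ₁ h₁.2.2) / Algebra.GrothendieckGroup.of (invDiv F δ₂ h₂.2) ∈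
      (biratSubfunctor F).carrier (baseObj F A) :=
  mem_biratSubfunctor_of_mem_biratGerms F ⟨Y, δ₁, δ₂, h₁, h₂, hb, rfl⟩

/-- `Φ^birat(X) ⊆ Φ(X)^gp` as a subgroup (the value of the subfunctor at `X ∈ Ob(D)`; name requested by
seat abc-iut-L1-t3 for its Prop. 4.4 (iii) bridge). [cite: MochizukiFrdI2008, Prop. 4.4 (iii) p.83] -/
abbrev biratSubgroup (X : D) : Subgroup (Algebra.GrothendieckGroup (Φ.obj (op X))) :=
  (biratSubfunctor F).carrier X

/-- `Φ^birat` is the SMALLEST subfunctor of groups of `Φ^gp` containing the germs: any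
`Ψ : GpSubfunctor Φ` with `biratGerms F A ⊆ Ψ(Base A)` for all `A` contains `Φ^birat` (this is how the
identification with the subfunctor of Prop. 4.4 (iii) goes, see the module docstring).
[cite: MochizukiFrdI2008, Prop. 4.4 (iii) p.83] -/
theorem biratSubfunctor_le (Ψ : GpSubfunctor Φ)
    (h : ∀ A : C, biratGerms F A ⊆ (Ψ.carrier (baseObj F A) : Set _)) (X : D) :
    (biratSubfunctor F).carrier X ≤ Ψ.carrier X := by
  rw [biratSubfunctor_carrier, Subgroup.closure_le]
  rintro _ ⟨A, f, d, hd, rfl⟩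
  exact Ψ.pull_mem f (h A hd)

end PreFrobenioid

end Literature.AlgebraicGeometry.Frobenioids
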